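import Summits.QuantumFields.YangMills.Theorems.ColdStartUniversalityLatticeLangevinLawUnique
import Summits.QuantumFields.YangMills.Theorems.ColdStartUniversalityUniformColdStartMixingRungOfLawUnique
import Summits.QuantumFields.YangMills.Theorems.ColdStartUniversalityUniformColdStartMixingIntegrand
import Summits.QuantumFields.YangMills.Theorems.ColdStartUniversalityUniformColdStartMixingCesaroStep
import HarnessLib

/-!
# Route `ColdStartUniversality`, crux K_A1 `UniformColdStartMixing` (stmt-QuantumFields-24809), rung
# `stub_fixedCutoffMixing`: the last reduction — (E3) Cesàro ergodicity ⇐ (M) POINTWISE MIXING of the cold start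

Helper file (seat `ym-line-csu-p1`).  After (E1) uniqueness in law (`coldStart_lawUnique`), the rung's remaining input
(E3) «for every bounded measurable `f` and `δ > 0` a lattice time `T₀` beyond which SOME cold-start solution has
`|∫ f dμ_{β'} − T⁻¹∫₀ᵀ E f(U_t) dt| ≤ δ`» follows from the textbook mixing statement

  (M) for every bounded measurable `f`, `δ > 0` there is `t₀` such that for every lattice time `t ≥ t₀` SOME
      cold-start solution has `|∫ f dμ_{β'} − E f(U_t)| ≤ δ`

(convergence of the cold-start law to the Wilson–Gibbs measure tested on bounded measurable observables — what
Doeblin/Harris or hypoelliptic heat-kernel bounds give for the elliptic SZZ diffusion on the compact `SU(2)^E`):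
by (E1) the expectations `E f(U_t)` do not depend on the solution, so (M) holds along ONE fixed cold-start
solution (the canonical one on the product Wiener space, `coldStart_solution`), whose Cesàro means then converge
(`abs_sub_inv_mul_integral_le_of_le`, the Cesàro bookkeeping of `…CesaroStep` for all large `T`; interval
integrability of `t ↦ E f(U_t)` by a jointly measurable modification, as in `integrandRegular`).

* `someSolutionErgodic_of_pointwiseMixing` : (M) ⇒ (E3);
* `fixedCutoffMixing_of_pointwiseMixing` : (M) ⇒ the rung `stub_fixedCutoffMixing`.

No definition, no sorry.  RECORD-rung R3 plumbing; (M) is OPEN (XL); nothing here bears on the mass gap. -/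

set_option autoImplicit false

noncomputable section

namespace Summit.QuantumFields.YangMills.Theorems.ColdStartUniversality

open MeasureTheory ProbabilityTheory intervalIntegral Filter Topology
open scoped NNReal ENNReal
open Literature.Probability.Process
open Literature.MathematicalPhysics.QuantumFieldTheory
open Literature.MathematicalPhysics.QuantumLattice (fundamentalRep fundamentalLatticeRep continuous_fundamentalRep)
open Literature.MathematicalPhysics.QuantumFieldTheory.Balaban1983to89

/-- **Cesàro bookkeeping for all large `T`**: if `|e| ≤ 1`, `|g| ≤ 1`, `g` is interval integrable on every `[0, T']`
and `|e − g s| ≤ η ≤ δ/2` for `s ≥ T_c > 0`, then `|e − T⁻¹∫₀ᵀ g| ≤ δ` for every `T ≥ T_c + 4T_c/δ`. [folklore] -/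
theorem abs_sub_inv_mul_integral_le_of_le {e : ℝ} {g : ℝ → ℝ} {Tc δ η : ℝ} (hTc : 0 < Tc) (hδ : 0 < δ)
    (hη : η ≤ δ / 2) (he : |e| ≤ 1) (hg : ∀ s, |g s| ≤ 1)
    (hgi : ∀ T', IntervalIntegrable g volume 0 T') (hmix : ∀ s, Tc ≤ s → |e - g s| ≤ η)
    {T : ℝ} (hT : Tc + 4 * Tc / δ ≤ T) :
    |e - T⁻¹ * ∫ s in (0 : ℝ)..T, g s| ≤ δ := by
  have hT0 : 0 < T := lt_of_lt_of_le (by positivity) hT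
  have hTcT : Tc ≤ T := le_trans (le_add_of_nonneg_right (by positivity)) hT
  have hgi' : ∀ a b : ℝ, IntervalIntegrable g volume a b := fun a b => ((hgi a).symm).trans (hgi b)
  have hci : ∀ a b : ℝ, IntervalIntegrable (fun s => e - g s) volume a b := fun a b =>
    (intervalIntegrable_const).sub (hgi' a b)
  have hint : ∫ s in (0 : ℝ)..T, (e - g s) = T * e - ∫ s in (0 : ℝ)..T, g s := by
    rw [intervalIntegral.integral_sub intervalIntegrable_const (hgi' 0 T), intervalIntegral.integral_const,
      sub_zero, smul_eq_mul]
  have hkey : e - T⁻¹ * ∫ s in (0 : ℝ)..T, g s = T⁻¹ * ∫ s in (0 : ℝ)..T, (e - g s) := by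
    rw [hint, mul_sub, ← mul_assoc, inv_mul_cancel₀ hT0.ne', one_mul]
  rw [hkey, abs_mul, abs_inv, abs_of_pos hT0]
  have hsplit : ∫ s in (0 : ℝ)..T, (e - g s) =
      (∫ s in (0 : ℝ)..Tc, (e - g s)) + ∫ s in Tc..T, (e - g s) :=
    (intervalIntegral.integral_add_adjacent_intervals (hci 0 Tc) (hci Tc T)).symm
  have h1 : |∫ s in (0 : ℝ)..Tc, (e - g s)| ≤ 2 * |Tc - 0| := by
    have := intervalIntegral.norm_integral_le_of_norm_le_const (a := 0) (b := Tc) (C := 2)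
      (f := fun s => e - g s) (fun s _ => by
        rw [Real.norm_eq_abs]
        calc |e - g s| ≤ |e| + |g s| := abs_sub _ _
          _ ≤ 1 + 1 := add_le_add he (hg s)
          _ = 2 := by norm_num)
    simpa [Real.norm_eq_abs] using this
  have h2 : |∫ s in Tc..T, (e - g s)| ≤ η * |T - Tc| := by
    have := intervalIntegral.norm_integral_le_of_norm_le_const (a := Tc) (b := T) (C := η)
      (f := fun s => e - g s) (fun s hs => by
        rw [Real.norm_eq_abs]
        have hs' : Tc < s := by
          rw [Set.uIoc_of_le hTcT] at hs
          exact hs.1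
        exact hmix s hs'.le)
    simpa [Real.norm_eq_abs] using this
  rw [sub_zero, abs_of_pos hTc] at h1
  rw [abs_of_nonneg (sub_nonneg.mpr hTcT)] at h2
  have h3 : |∫ s in (0 : ℝ)..T, (e - g s)| ≤ 2 * Tc + η * (T - Tc) := by
    rw [hsplit]
    exact (abs_add_le _ _).trans (add_le_add h1 h2)
  have hη0 : 0 ≤ η := (abs_nonneg _).trans (hmix Tc le_rfl)
  have h4 : 2 * Tc + η * (T - Tc) ≤ 2 * Tc + δ / 2 * T := by
    have : η * (T - Tc) ≤ δ / 2 * T := by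
      calc η * (T - Tc) ≤ η * T := by gcongr; linarith
        _ ≤ δ / 2 * T := by gcongr
    linarith
  have h5 : T⁻¹ * (2 * Tc + δ / 2 * T) ≤ δ := by
    rw [inv_mul_le_iff₀ hT0]
    have hT4 : 4 * Tc / δ ≤ T := le_trans (le_add_of_nonneg_left hTc.le) hT
    have : 2 * Tc ≤ δ / 2 * T :=
      calc 2 * Tc = δ / 2 * (4 * Tc / δ) := by field_simp; ring
        _ ≤ δ / 2 * T := by gcongr
    linarith
  calc T⁻¹ * |∫ s in (0 : ℝ)..T, (e - g s)| ≤ T⁻¹ * (2 * Tc + η * (T - Tc)) := by gcongr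
    _ ≤ T⁻¹ * (2 * Tc + δ / 2 * T) := by gcongr
    _ ≤ δ := h5

/-- Along any solution, `t ↦ E f(U_t)` (bounded measurable `f`) is bounded by `1` and interval integrable on every
`[0, T]` (jointly measurable modification of the a.s. continuous adapted solution, Fubini). [folklore] -/
theorem integrand_bound_and_intervalIntegrable {Ω : Type*} {mΩ : MeasurableSpace Ω} {P : Measure Ω}
    [IsProbabilityMeasure P] {L : ℕ} [NeZero L] {β' : ℝ}
    {W : ℝ≥0 → Ω → (Edge 3 L × NoiseIdx 2 → ℝ)} (hW : IsFlatBrownian W P)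
    {U : ℝ≥0 → Ω → GaugeConfig 3 L (Matrix.specialUnitaryGroup (Fin 2) ℂ)}
    (hU : (latticeLangevinDynamics (fundamentalLatticeRep 2) β').IsSolution (fundamentalRep (Fin 2))
      hW.natFiltration P W U)
    {f : GaugeConfig 3 L (Matrix.specialUnitaryGroup (Fin 2) ℂ) → ℝ} (hfm : Measurable f) (hfb : ∀ V, |f V| ≤ 1) :
    (∀ t : ℝ, |∫ ω, f (U t.toNNReal ω) ∂P| ≤ 1) ∧
      ∀ T : ℝ, IntervalIntegrable (fun t : ℝ => ∫ ω, f (U t.toNNReal ω) ∂P) volume 0 T := by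
  have hfn : ∀ V, ‖f V‖ ≤ 1 := fun V => by rw [Real.norm_eq_abs]; exact hfb V
  have hbd : ∀ t : ℝ, |∫ ω, f (U t.toNNReal ω) ∂P| ≤ 1 := fun t => by
    have h := norm_integral_le_of_norm_le_const (μ := P) (ae_of_all _ fun ω => hfn (U t.toNNReal ω))
    rw [Real.norm_eq_abs, probReal_univ, mul_one] at h
    exact h
  refine ⟨hbd, fun T => ?_⟩
  have hmU : ∀ t, Measurable (U t) := fun t => (hU.adapted t).mono (hW.natFiltration.le t) le_rfl
  obtain ⟨N, Ut, hN, hN0, hUt, hunc⟩ := exists_null_modification_measurable_uncurry hmU hU.continuous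
  have hjoint : Measurable (Function.uncurry fun (s : ℝ) (ω : Ω) => f (Ut s.toNNReal ω)) := by
    have h1 : Measurable fun p : ℝ × Ω => (p.1.toNNReal, p.2) :=
      (measurable_fst.real_toNNReal).prodMk measurable_snd
    exact hfm.comp (hunc.comp h1)
  have hgm : StronglyMeasurable fun s : ℝ => ∫ ω, f (Ut s.toNNReal ω) ∂P :=
    StronglyMeasurable.integral_prod_right hjoint.stronglyMeasurable
  have hae : ∀ s : ℝ, (∫ ω, f (Ut s.toNNReal ω) ∂P) = ∫ ω, f (U s.toNNReal ω) ∂P := by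
    intro s
    refine integral_congr_ae ?_
    have hNae : ∀ᵐ ω ∂P, ω ∉ N := by rw [ae_iff]; simpa using hN0
    filter_upwards [hNae] with ω hω
    rw [hUt ω hω]
  have hgm' : AEStronglyMeasurable (fun s : ℝ => ∫ ω, f (U s.toNNReal ω) ∂P) (volume.restrict (Set.uIoc 0 T)) := by
    have : (fun s : ℝ => ∫ ω, f (U s.toNNReal ω) ∂P) = fun s : ℝ => ∫ ω, f (Ut s.toNNReal ω) ∂P :=
      funext fun s => (hae s).symm
    rw [this]
    exact hgm.aestronglyMeasurable
  rw [intervalIntegrable_iff]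
  refine Integrable.mono' (g := fun _ => (1 : ℝ)) ?_ hgm' (ae_of_all _ fun s => ?_)
  · exact integrableOn_const (by simp [Real.volume_uIoc])
  · have h := norm_integral_le_of_norm_le_const (μ := P) (ae_of_all _ fun ω => hfn (U (s.toNNReal) ω))
    rw [probReal_univ, mul_one] at h
    exact h

/-- **(E3) from (M)**: pointwise mixing of SOME cold-start solution at each large time (bounded measurable
observables) implies Cesàro ergodicity along some cold-start solution — by uniqueness in law (`coldStart_lawUnique`)
the expectations `E f(U_t)` are solution-independent, so (M) holds along the canonical cold-start solution, whose
Cesàro means converge. [folklore] -/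
theorem someSolutionErgodic_of_pointwiseMixing
    (hM : ∀ (L : ℕ) [NeZero L] (β' : ℝ)
      (f : GaugeConfig 3 L (Matrix.specialUnitaryGroup (Fin 2) ℂ) → ℝ), Measurable f → (∀ V, |f V| ≤ 1) →
      ∀ δ : ℝ, 0 < δ → ∃ t₀ : ℝ, ∀ t : ℝ, t₀ ≤ t →
        ∃ (Ω : Type) (_mΩ : MeasurableSpace Ω) (P : Measure Ω) (_hP : IsProbabilityMeasure P)
          (W : ℝ≥0 → Ω → (Edge 3 L × NoiseIdx 2 → ℝ)) (hW : IsFlatBrownian W P)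
          (U : ℝ≥0 → Ω → GaugeConfig 3 L (Matrix.specialUnitaryGroup (Fin 2) ℂ)),
          (∀ ω, U 0 ω = fun _ => 1) ∧
          (latticeLangevinDynamics (fundamentalLatticeRep 2) β').IsSolution (fundamentalRep (Fin 2))
            hW.natFiltration P W U ∧
          |(∫ V, f V ∂(wilsonMeasure (d := 3) (L := L) (fundamentalRep (Fin 2)) β')) -
              ∫ ω, f (U t.toNNReal ω) ∂P| ≤ δ) :
    ∀ (L : ℕ) [NeZero L] (β' : ℝ)
      (f : GaugeConfig 3 L (Matrix.specialUnitaryGroup (Fin 2) ℂ) → ℝ), Measurable f → (∀ V, |f V| ≤ 1) →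
      ∀ δ : ℝ, 0 < δ → ∃ T₀ : ℝ, 0 < T₀ ∧ ∀ T : ℝ, T₀ ≤ T →
        ∃ (Ω : Type) (_mΩ : MeasurableSpace Ω) (P : Measure Ω) (_hP : IsProbabilityMeasure P)
          (W : ℝ≥0 → Ω → (Edge 3 L × NoiseIdx 2 → ℝ)) (hW : IsFlatBrownian W P)
          (U : ℝ≥0 → Ω → GaugeConfig 3 L (Matrix.specialUnitaryGroup (Fin 2) ℂ)),
          (∀ ω, U 0 ω = fun _ => 1) ∧
          (latticeLangevinDynamics (fundamentalLatticeRep 2) β').IsSolution (fundamentalRep (Fin 2))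
            hW.natFiltration P W U ∧
          |(∫ V, f V ∂(wilsonMeasure (d := 3) (L := L) (fundamentalRep (Fin 2)) β')) -
              T⁻¹ * ∫ t in (0 : ℝ)..T, (∫ ω, f (U t.toNNReal ω) ∂P)| ≤ δ := by
  intro L _ β' f hfm hfb δ hδ
  -- the canonical cold-start solution on the product Wiener space
  haveI := isProbabilityMeasure_piWiener (Edge 3 L × NoiseIdx 2)
  set hWc := isFlatBrownian_piWiener 3 L (NoiseIdx 2) with hWc_def
  obtain ⟨Uc, hUc0, hUc⟩ := solution_from_start hWc β' (fun _ => 1)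
  -- (M) with δ/2, transferred to the canonical solution by uniqueness in law
  obtain ⟨t₀, ht₀⟩ := hM L β' f hfm hfb (δ / 2) (by positivity)
  set e : ℝ := ∫ V, f V ∂(wilsonMeasure (d := 3) (L := L) (fundamentalRep (Fin 2)) β') with he_def
  set g : ℝ → ℝ := fun t => ∫ ω, f (Uc t.toNNReal ω) ∂(Measure.pi fun _ : Edge 3 L × NoiseIdx 2 => preWienerMeasure)
    with hg_def
  have hclose : ∀ t : ℝ, max t₀ 1 ≤ t → |e - g t| ≤ δ / 2 := by
    intro t ht
    obtain ⟨Ω, mΩ, P, hP, W, hW, U, hU0, hU, hb⟩ := ht₀ t ((le_max_left _ _).trans ht)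
    have hlaw := coldStart_lawUnique L β' Ω mΩ P hP W hW U _ _ _ inferInstance _ hWc Uc hU0 hU hUc0 hUc t.toNNReal
    have hmU : Measurable (U t.toNNReal) := (hU.adapted _).mono (hW.natFiltration.le _) le_rfl
    have hmUc : Measurable (Uc t.toNNReal) := (hUc.adapted _).mono (hWc.natFiltration.le _) le_rfl
    have hEq : (∫ ω, f (U t.toNNReal ω) ∂P) = g t := by
      rw [hg_def]
      simp only
      rw [← integral_map hmU.aemeasurable hfm.aestronglyMeasurable,
        ← integral_map hmUc.aemeasurable hfm.aestronglyMeasurable, hlaw]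
    rw [← hEq]
    exact hb
  -- bounds and integrability along the canonical solution
  obtain ⟨hgb, hgi⟩ := integrand_bound_and_intervalIntegrable hWc hUc hfm hfb
  have he1 : |e| ≤ 1 := by
    haveI := isProbabilityMeasure_wilsonMeasure (d := 3) (L := L) (G := Matrix.specialUnitaryGroup (Fin 2) ℂ)
      (fundamentalRep (Fin 2)) (continuous_fundamentalRep (Fin 2)) β'
    have h := norm_integral_le_of_norm_le_const (μ := wilsonMeasure (d := 3) (L := L) (fundamentalRep (Fin 2)) β')
      (ae_of_all _ fun V => (show ‖f V‖ ≤ 1 by rw [Real.norm_eq_abs]; exact hfb V))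
    rw [Real.norm_eq_abs, probReal_univ, mul_one] at h
    exact h
  set Tc : ℝ := max t₀ 1 with hTc
  have hTc0 : 0 < Tc := lt_of_lt_of_le one_pos (le_max_right _ _)
  refine ⟨Tc + 4 * Tc / δ, by positivity, fun T hT => ?_⟩
  refine ⟨_, inferInstance, _, inferInstance, _, hWc, Uc, hUc0, hUc, ?_⟩
  exact abs_sub_inv_mul_integral_le_of_le hTc0 hδ le_rfl he1 hgb hgi hclose hT

/-- **The rung `stub_fixedCutoffMixing` from the single input (M) = pointwise mixing of the cold start** (bounded
measurable observables, some solution at each large time), via `someSolutionErgodic_of_pointwiseMixing`, the tree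
theorem (E1) `coldStart_lawUnique` and `fixedCutoffMixing_of_lawUnique`. [folklore] -/
theorem fixedCutoffMixing_of_pointwiseMixing
    (hM : ∀ (L : ℕ) [NeZero L] (β' : ℝ)
      (f : GaugeConfig 3 L (Matrix.specialUnitaryGroup (Fin 2) ℂ) → ℝ), Measurable f → (∀ V, |f V| ≤ 1) →
      ∀ δ : ℝ, 0 < δ → ∃ t₀ : ℝ, ∀ t : ℝ, t₀ ≤ t →
        ∃ (Ω : Type) (_mΩ : MeasurableSpace Ω) (P : Measure Ω) (_hP : IsProbabilityMeasure P)
          (W : ℝ≥0 → Ω → (Edge 3 L × NoiseIdx 2 → ℝ)) (hW : IsFlatBrownian W P)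
          (U : ℝ≥0 → Ω → GaugeConfig 3 L (Matrix.specialUnitaryGroup (Fin 2) ℂ)),
          (∀ ω, U 0 ω = fun _ => 1) ∧
          (latticeLangevinDynamics (fundamentalLatticeRep 2) β').IsSolution (fundamentalRep (Fin 2))
            hW.natFiltration P W U ∧
          |(∫ V, f V ∂(wilsonMeasure (d := 3) (L := L) (fundamentalRep (Fin 2)) β')) -
              ∫ ω, f (U t.toNNReal ω) ∂P| ≤ δ) :
    ∀ (F : T3ContinuumYM3Torus.T3Family) (γ : ℝ), 0 < γ →
      ∀ (os : List (T3ContinuumYM3Torus.ULoop3 F)) (δ : ℝ), 0 < δ → ∀ K : ℕ, ∃ T : ℝ, 0 < T ∧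
        ∀ (Ω : Type) (mΩ : MeasurableSpace Ω) (P : Measure Ω) (hP : IsProbabilityMeasure P)
          (W : ℝ≥0 → Ω → (Edge 3 ((F.P K).sitesPerDir 0) × NoiseIdx 2 → ℝ)) (hW : IsFlatBrownian W P)
          (U : ℝ≥0 → Ω → GaugeConfig 3 ((F.P K).sitesPerDir 0) (Matrix.specialUnitaryGroup (Fin 2) ℂ)),
          (∀ ω, U 0 ω = fun _ => 1) →
          (latticeLangevinDynamics (fundamentalLatticeRep 2) ((γ * (F.P K).eps)⁻¹ / 2)).IsSolution
            (fundamentalRep (Fin 2)) hW.natFiltration P W U →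
          |(F.scheme (ExpMeanLog.expMeanLogSU : LoopAverage (Matrix.specialUnitaryGroup (Fin 2) ℂ)) γ).expectAt
                K os -
              T⁻¹ * ∫ s in (0 : ℝ)..T, (∫ ω, (os.map fun C => F.avgObs (ExpMeanLog.expMeanLogSU :
                  LoopAverage (Matrix.specialUnitaryGroup (Fin 2) ℂ)) K C
                (fun b : PBond (F.P K) 0 => U (s / (F.P K).eps).toNNReal ω (b.src, b.dir))).prod ∂P)| ≤ δ :=
  fixedCutoffMixing_of_lawUnique coldStart_lawUnique (someSolutionErgodic_of_pointwiseMixing hM)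

end Summit.QuantumFields.YangMills.Theorems.ColdStartUniversality

end
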